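import Summits.SmoothPoincare4.SmoothPoincare4.Theorems.SullivanDualWitnessChargeDefs
import Literature.Geometry.Symplectic.JPlanePencilLocalFamily

/-!
# Deep stub A' of line `Sketch` (crux `WitnessCharge`, stmt-SmoothPoincare4-7824) from the named fact

`substub_localFamilyUniv` of skeleton v7c — the IFT chart of the moduli space of pencil members at
a member, existence AND universality (input L2: Gromov 1985 2.4.A′ / Hofer–Lizan–Sikorav 1997 /
Wendl LNM 2216 Prop. 2.53, Thm 2.46, Thm 2.11) — is the instantiation `M := Σ` of the Literature
named fact `Literature.Geometry.Symplectic.jPlanePencil_localFamily`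
(`Literature/Geometry/Symplectic/JPlanePencilLocalFamily.lean`), whose member predicate
`IsPencilPlane` / coordinates `pencilCoord` are this line's `IsPencilMember` / `Ycoord` for a general
compact 4-manifold (so the identification is `Iff.rfl`). With this file the line has NO Summits-side
`sorry`: its two open stubs are the discharges of two Literature named facts (this one and McDuff's
`jHolomorphicLimitOfEmbedded_isEmbedded`). Continuation lead c5, cycle 5.
-/

noncomputable section

set_option linter.dupNamespace false

open scoped Manifold ContDiff Topology
open Set Filter Literature.Geometry.Symplectic Literature.Topology.FourManifolds

namespace Summit.SmoothPoincare4.SmoothPoincare4.Theorems.WitnessCharge.PencilIncompleteness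

variable {S : HomotopySphere 4} {p : S.carrier}

/-- The line's flat coordinates are the Literature `pencilCoord` (definitional). -/
theorem Ycoord_eq_pencilCoord (x : punctured p) : Ycoord p x = pencilCoord p x := rfl

/-- The line's pencil members are the Literature pencil planes (definitional). -/
theorem isPencilMember_iff_isPencilPlane
    {J : ∀ x : punctured p, TangentSpace (𝓡 4) x →L[ℝ] TangentSpace (𝓡 4) x}
    {u : ℂ → punctured p} {b : ℂ} :
    IsPencilMember J u b ↔ IsPencilPlane J u b := Iff.rfl

/-- **Deep stub A' (`substub_localFamilyUniv`, registered signature) from the named fact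
`jPlanePencil_localFamily`** (instantiation `M := Σ`): at a member `u₀` of intercept `b₀` there are
`δ > 0` and a jointly smooth family `Floc` of members over `ball b₀ δ`, `Floc b₀ = u₀`, with injective
differential, and a `C⁰`-neighbourhood of `u₀` over a disc in which the only members of intercept
`b ∈ ball b₀ δ` are the `Floc b`. -/
theorem substub_localFamilyUniv_of_pencilLocalFamily :
    Literature.Geometry.Symplectic.jPlanePencil_localFamily →
    ∀ (S : HomotopySphere 4) (p : S.carrier)
      (J : ∀ x : punctured p, TangentSpace (𝓡 4) x →L[ℝ] TangentSpace (𝓡 4) x) (ε' : ℝ),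
      0 < ε' →
      Metric.closedBall (extChartAt (𝓡 4) p p) ε' ⊆ (extChartAt (𝓡 4) p).target →
      (∀ (x : punctured p) (v : TangentSpace (𝓡 4) x), J x (J x v) = -v) →
      (∀ x₀ : punctured p, ContMDiffAt (𝓡 4) 𝓘(ℝ, EuclideanSpace ℝ (Fin 4) →L[ℝ] EuclideanSpace ℝ (Fin 4)) ∞
        (inTangentCoordinates (𝓡 4) (𝓡 4) (id : punctured p → punctured p) id (fun x => J x) x₀) x₀) →
      (∀ x : punctured p, InPuncturedChartBall p ε' x →
        ∀ (v : TangentSpace (𝓡 4) x) (b : EuclideanSpace ℝ (Fin 4)),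
          inner ℝ (fderiv ℝ inversion (extChartAt (𝓡 4) p x.1 - extChartAt (𝓡 4) p p)
            (mfderiv (𝓡 4) 𝓘(ℝ, EuclideanSpace ℝ (Fin 4))
              (fun z : punctured p => extChartAt (𝓡 4) p z.1) x (J x v))) b
          = stdSymplecticForm (fderiv ℝ inversion (extChartAt (𝓡 4) p x.1 - extChartAt (𝓡 4) p p)
            (mfderiv (𝓡 4) 𝓘(ℝ, EuclideanSpace ℝ (Fin 4))
              (fun z : punctured p => extChartAt (𝓡 4) p z.1) x v)) b) →
      ∀ (u₀ : ℂ → punctured p) (b₀ : ℂ), IsPencilMember J u₀ b₀ →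
        ∃ δ : ℝ, 0 < δ ∧ ∃ Floc : ℂ → ℂ → punctured p, Floc b₀ = u₀ ∧
          (∀ b ∈ Metric.ball b₀ δ, IsPencilMember J (Floc b) b) ∧
          ContMDiffOn 𝓘(ℝ, ℂ × ℂ) (𝓡 4) ∞ (fun q : ℂ × ℂ => Floc q.1 q.2)
            ((Metric.ball b₀ δ) ×ˢ (univ : Set ℂ)) ∧
          (∀ q : ℂ × ℂ, q.1 ∈ Metric.ball b₀ δ →
            Function.Injective (mfderiv 𝓘(ℝ, ℂ × ℂ) (𝓡 4) (fun q : ℂ × ℂ => Floc q.1 q.2) q)) ∧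
          ∃ (r₀ : ℝ) (V : Set (ℂ × punctured p)), IsOpen V ∧ (∀ ξ : ℂ, (ξ, u₀ ξ) ∈ V) ∧
            ∀ (u : ℂ → punctured p) (b : ℂ), IsPencilMember J u b → b ∈ Metric.ball b₀ δ →
              (∀ ξ : ℂ, ‖ξ‖ ≤ r₀ → (ξ, u ξ) ∈ V) → u = Floc b := by
  intro hL2 S p J ε' hε' hball hJ2 hJs hstd u₀ b₀ hu₀
  exact hL2 S.carrier p J ε' hε' hball hJ2 hJs hstd u₀ b₀ hu₀

/-- **Deep stub A' (`substub_localFamilyUniv`) from the CORRECTED named fact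
`jPlanePencil_localFamily_homotopySphere`** (the general-`M` fact `jPlanePencil_localFamily` used
above is FALSE — erratum and counterexample `ℂP²‾` in `JPlanePencilLocalFamily.lean`; the corrected
fact carries the homotopy-sphere hypothesis, which the instantiation `M := Σ` discharges with
`S.nonempty_homotopyEquiv`). Registered helper; supersedes
`substub_localFamilyUniv_of_pencilLocalFamily` for every consumer. -/
theorem substub_localFamilyUniv_of_pencilLocalFamily_homotopySphere :
    Literature.Geometry.Symplectic.jPlanePencil_localFamily_homotopySphere →
    ∀ (S : HomotopySphere 4) (p : S.carrier)
      (J : ∀ x : punctured p, TangentSpace (𝓡 4) x →L[ℝ] TangentSpace (𝓡 4) x) (ε' : ℝ),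
      0 < ε' →
      Metric.closedBall (extChartAt (𝓡 4) p p) ε' ⊆ (extChartAt (𝓡 4) p).target →
      (∀ (x : punctured p) (v : TangentSpace (𝓡 4) x), J x (J x v) = -v) →
      (∀ x₀ : punctured p, ContMDiffAt (𝓡 4) 𝓘(ℝ, EuclideanSpace ℝ (Fin 4) →L[ℝ] EuclideanSpace ℝ (Fin 4)) ∞
        (inTangentCoordinates (𝓡 4) (𝓡 4) (id : punctured p → punctured p) id (fun x => J x) x₀) x₀) →
      (∀ x : punctured p, InPuncturedChartBall p ε' x →
        ∀ (v : TangentSpace (𝓡 4) x) (b : EuclideanSpace ℝ (Fin 4)),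
          inner ℝ (fderiv ℝ inversion (extChartAt (𝓡 4) p x.1 - extChartAt (𝓡 4) p p)
            (mfderiv (𝓡 4) 𝓘(ℝ, EuclideanSpace ℝ (Fin 4))
              (fun z : punctured p => extChartAt (𝓡 4) p z.1) x (J x v))) b
          = stdSymplecticForm (fderiv ℝ inversion (extChartAt (𝓡 4) p x.1 - extChartAt (𝓡 4) p p)
            (mfderiv (𝓡 4) 𝓘(ℝ, EuclideanSpace ℝ (Fin 4))
              (fun z : punctured p => extChartAt (𝓡 4) p z.1) x v)) b) →
      ∀ (u₀ : ℂ → punctured p) (b₀ : ℂ), IsPencilMember J u₀ b₀ →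
        ∃ δ : ℝ, 0 < δ ∧ ∃ Floc : ℂ → ℂ → punctured p, Floc b₀ = u₀ ∧
          (∀ b ∈ Metric.ball b₀ δ, IsPencilMember J (Floc b) b) ∧
          ContMDiffOn 𝓘(ℝ, ℂ × ℂ) (𝓡 4) ∞ (fun q : ℂ × ℂ => Floc q.1 q.2)
            ((Metric.ball b₀ δ) ×ˢ (univ : Set ℂ)) ∧
          (∀ q : ℂ × ℂ, q.1 ∈ Metric.ball b₀ δ →
            Function.Injective (mfderiv 𝓘(ℝ, ℂ × ℂ) (𝓡 4) (fun q : ℂ × ℂ => Floc q.1 q.2) q)) ∧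
          ∃ (r₀ : ℝ) (V : Set (ℂ × punctured p)), IsOpen V ∧ (∀ ξ : ℂ, (ξ, u₀ ξ) ∈ V) ∧
            ∀ (u : ℂ → punctured p) (b : ℂ), IsPencilMember J u b → b ∈ Metric.ball b₀ δ →
              (∀ ξ : ℂ, ‖ξ‖ ≤ r₀ → (ξ, u ξ) ∈ V) → u = Floc b := by
  intro hL2 S p J ε' hε' hball hJ2 hJs hstd u₀ b₀ hu₀
  exact hL2 S.carrier S.nonempty_homotopyEquiv p J ε' hε' hball hJ2 hJs hstd u₀ b₀ hu₀

end Summit.SmoothPoincare4.SmoothPoincare4.Theorems.WitnessCharge.PencilIncompleteness
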